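import Mathlib
import Summits.MatrixMultiplication.MatrixMultiplication.Theses.SnSubsetDichotomy
import Summits.MatrixMultiplication.MatrixMultiplication.Theorems.SnSubsetDichotomyNoThresholdSubsetTripleStubTransfer

/-!
# `SnSubsetDichotomy.DichotomyInduction` — the glue `GlobalBranch → JuntaBranch → NoThresholdSubsetTriple`

Item `stmt-MatrixMultiplication-8309` of route `SnSubsetDichotomy` (support, "the glue"): the two
branches of the density-increment dichotomy on umvirates imply the negative side
`NoThresholdSubsetTriple` of the symmetric-group subsets question
(Blasiak–Church–Cohn–Grochow–Umans 2017, §4; the descent is the bookkeeping behind their Thm 4.2).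

Proof (elementary potential argument).  Let `ε, c₁, n₁` be the data of `GlobalBranch`, put
`c₀ := min (c₁/2) (1/2)` and let `n₂` be the threshold of `JuntaBranch` at `(ε, c₀)`;
`M := max n₁ n₂ + 1`, `n₀ := 2M`.  Suppose `n ≥ n₀` and a TPP triple in `S_n` has
`|S||T||U| > (n!)^{3/2} e^{-c₀√n}`.  By induction on `k` we produce (`R k`) a level `m ≤ n` with
`m ≥ n - k√n` and a TPP triple in `S_m` with `e^k · (m!)^{3/2} e^{-c₀√m} ≤ |S||T||U|`, as long as
`k ≤ c₀√n` (then `m ≥ n/2 ≥ M`, since `c₀ ≤ 1/2`): if the triple at level `m` has no super-neutral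
bump, `GlobalBranch` bounds it by `(m!)^{3/2} e^{-c₁√m}`, absurd since `c₀ < c₁` and `m ≥ 1`;
otherwise `JuntaBranch` gives a TPP triple at a level `m' ∈ [m - √m, m)` whose normalised volume is
multiplied by `e^{c₀+1}`, and `√m - √m' ≤ 1` turns this into `R (k+1)`.  At `K := ⌊c₀√n⌋ + 1` the
packing bound `|S||T||U| ≤ (m!)^{3/2}` (`tpp_perm_card_mul_card_le_factorial`, Cohn–Umans 2003
Lemma 3.1 in three rotations) forces `K ≤ c₀√m ≤ c₀√n < K` — contradiction.

Only Mathlib real analysis and the tree's packing lemma are used; no named facts.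
-/

namespace Summit.MatrixMultiplication.MatrixMultiplication.Theorems

open Literature.Combinatorics.Additive
open Summit.MatrixMultiplication.MatrixMultiplication.Theses.SnSubsetDichotomy

/-- Packing in real form: a TPP triple `S, T, U ⊆ S_n` has `|S||T||U| ≤ (n!)^{3/2}`
(square the three pairwise packing bounds `|S||T|, |T||U|, |U||S| ≤ n!`; an empty set makes the
left side `0`). [folklore] -/
theorem dichotomyInduction_card_le_rpow {n : ℕ} {S T U : Finset (Equiv.Perm (Fin n))}
    (hTPP : TripleProductProperty S T U) :
    ((S.card * T.card * U.card : ℕ) : ℝ) ≤ (n.factorial : ℝ) ^ ((3 : ℝ) / 2) := by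
  have hf : (0 : ℝ) < n.factorial := by exact_mod_cast n.factorial_pos
  by_cases h0 : S.card * T.card * U.card = 0
  · rw [h0, Nat.cast_zero]
    positivity
  have hS : S.card ≠ 0 := fun h => h0 (by simp [h])
  have hT : T.card ≠ 0 := fun h => h0 (by simp [h])
  have hU : U.card ≠ 0 := fun h => h0 (by simp [h])
  obtain ⟨h1, h2, h3⟩ := tpp_perm_card_mul_card_le_factorial hTPP hS hT hU
  have hsq : (S.card * T.card * U.card) ^ 2 ≤ n.factorial ^ 3 := by
    calc (S.card * T.card * U.card) ^ 2
        = (S.card * T.card) * (T.card * U.card) * (U.card * S.card) := by ring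
      _ ≤ n.factorial * n.factorial * n.factorial := Nat.mul_le_mul (Nat.mul_le_mul h1 h2) h3
      _ = n.factorial ^ 3 := by ring
  have hrpow : (n.factorial : ℝ) ^ ((3 : ℝ) / 2) = n.factorial * Real.sqrt n.factorial := by
    rw [Real.rpow_div_two_eq_sqrt _ hf.le, Real.rpow_ofNat, pow_succ, Real.sq_sqrt hf.le]
  rw [hrpow]
  refine le_of_pow_le_pow_left₀ two_ne_zero (by positivity) ?_
  calc ((S.card * T.card * U.card : ℕ) : ℝ) ^ 2
      = (((S.card * T.card * U.card) ^ 2 : ℕ) : ℝ) := by push_cast; ring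
    _ ≤ ((n.factorial ^ 3 : ℕ) : ℝ) := by exact_mod_cast hsq
    _ = ((n.factorial : ℝ) * Real.sqrt n.factorial) ^ 2 := by
        rw [mul_pow, Real.sq_sqrt hf.le]; push_cast; ring

/-- If `x - √x ≤ y` then `√x - 1 ≤ √y` (for `0 ≤ x`): one descent step `n ↦ n' ≥ n - √n` lowers
`√n` by at most `1`. [folklore] -/
theorem dichotomyInduction_sqrt_sub_one_le {x y : ℝ} (hx : 0 ≤ x) (hy : x - Real.sqrt x ≤ y) :
    Real.sqrt x - 1 ≤ Real.sqrt y := by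
  rcases le_or_gt (Real.sqrt x) 1 with h1 | h1
  · linarith [Real.sqrt_nonneg y]
  · rw [Real.le_sqrt' (by linarith)]
    nlinarith [Real.sq_sqrt hx]

/-- Logic helper: from `h : A → C`, either `A` (and then `C`) or `¬A` — lets the proof case on the
bump-freeness hypothesis of `GlobalBranch` without restating it. [folklore] -/
theorem dichotomyInduction_and_or_not {A C : Prop} (h : A → C) : (A ∧ C) ∨ ¬A := by
  by_cases hA : A
  · exact Or.inl ⟨hA, h hA⟩
  · exact Or.inr hA

/-- Potential bookkeeping of one descent step: if `e^k f^{3/2} e^{-c₀ s} ≤ P` (level `m`, `f = m!`,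
`s = √m`) and the new triple has `e^{c₀+1} P (f'/f)^{3/2} ≤ P'` with `s - s' ≤ 1`, then
`e^{k+1} f'^{3/2} e^{-c₀ s'} ≤ P'`. [folklore] -/
theorem dichotomyInduction_potential_step {c₀ k s s' f f' P P' : ℝ} (hc₀ : 0 < c₀) (hf : 0 < f)
    (hf' : 0 ≤ f') (hss' : s - s' ≤ 1)
    (hP : Real.exp k * (f ^ ((3 : ℝ) / 2) * Real.exp (-(c₀ * s))) ≤ P)
    (hP' : Real.exp (c₀ + 1) * P * (f' / f) ^ ((3 : ℝ) / 2) ≤ P') :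
    Real.exp (k + 1) * (f' ^ ((3 : ℝ) / 2) * Real.exp (-(c₀ * s'))) ≤ P' := by
  have hf32 : 0 < f ^ ((3 : ℝ) / 2) := Real.rpow_pos_of_pos hf _
  have hf'32 : 0 ≤ f' ^ ((3 : ℝ) / 2) := Real.rpow_nonneg hf' _
  have hdiv : (f' / f) ^ ((3 : ℝ) / 2) = f' ^ ((3 : ℝ) / 2) / f ^ ((3 : ℝ) / 2) :=
    Real.div_rpow hf' hf.le _
  have h1 : Real.exp (c₀ + 1) * (Real.exp k * (f ^ ((3 : ℝ) / 2) * Real.exp (-(c₀ * s)))) *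
      (f' / f) ^ ((3 : ℝ) / 2) ≤ P' := by
    refine le_trans ?_ hP'
    refine mul_le_mul_of_nonneg_right ?_ (Real.rpow_nonneg (div_nonneg hf' hf.le) _)
    exact mul_le_mul_of_nonneg_left hP (Real.exp_pos _).le
  have h2 : Real.exp (c₀ + 1) * (Real.exp k * (f ^ ((3 : ℝ) / 2) * Real.exp (-(c₀ * s)))) *
      (f' / f) ^ ((3 : ℝ) / 2) = Real.exp (c₀ + 1 + k + -(c₀ * s)) * f' ^ ((3 : ℝ) / 2) := by
    rw [hdiv, show c₀ + 1 + k + -(c₀ * s) = (c₀ + 1) + (k + -(c₀ * s)) by ring,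
      Real.exp_add (c₀ + 1) (k + -(c₀ * s)), Real.exp_add k (-(c₀ * s))]
    field_simp
  rw [h2] at h1
  refine le_trans ?_ h1
  have h3 : Real.exp (k + 1) * (f' ^ ((3 : ℝ) / 2) * Real.exp (-(c₀ * s'))) =
      Real.exp (k + 1 + -(c₀ * s')) * f' ^ ((3 : ℝ) / 2) := by
    rw [Real.exp_add (k + 1)]
    ring
  rw [h3]
  refine mul_le_mul_of_nonneg_right (Real.exp_le_exp.2 ?_) hf'32
  have h4 : c₀ * (s - s') ≤ c₀ * 1 := mul_le_mul_of_nonneg_left hss' hc₀.le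
  rw [mul_sub, mul_one] at h4
  linarith

/-- The bump-free case is absurd: `e^k f^{3/2} e^{-c₀ s} ≤ P ≤ f^{3/2} e^{-c₁ s}` is impossible for
`k ≥ 0`, `c₀ < c₁`, `s > 0`. [folklore] -/
theorem dichotomyInduction_nobump_absurd {c₀ c₁ k s f P : ℝ} (hf : 0 < f) (hk : 0 ≤ k)
    (hc : c₀ < c₁) (hs : 0 < s)
    (hP : Real.exp k * (f ^ ((3 : ℝ) / 2) * Real.exp (-(c₀ * s))) ≤ P)
    (hG : P ≤ f ^ ((3 : ℝ) / 2) * Real.exp (-(c₁ * s))) : False := by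
  have hf32 : 0 < f ^ ((3 : ℝ) / 2) := Real.rpow_pos_of_pos hf _
  have h := hP.trans hG
  have h2 : Real.exp k * Real.exp (-(c₀ * s)) ≤ Real.exp (-(c₁ * s)) := by
    refine le_of_mul_le_mul_right ?_ hf32
    calc Real.exp k * Real.exp (-(c₀ * s)) * f ^ ((3 : ℝ) / 2)
        = Real.exp k * (f ^ ((3 : ℝ) / 2) * Real.exp (-(c₀ * s))) := by ring
      _ ≤ f ^ ((3 : ℝ) / 2) * Real.exp (-(c₁ * s)) := h
      _ = Real.exp (-(c₁ * s)) * f ^ ((3 : ℝ) / 2) := by ring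
  rw [← Real.exp_add, Real.exp_le_exp] at h2
  have h3 : 0 < c₁ * s - c₀ * s := by
    rw [← sub_mul]
    exact mul_pos (sub_pos.2 hc) hs
  linarith

/-- The end of the descent is absurd: `e^K f^{3/2} e^{-c₀ s} ≤ P ≤ f^{3/2}` with `c₀ s ≤ c₀ σ < K`
is impossible. [folklore] -/
theorem dichotomyInduction_final_absurd {c₀ K s σ f P : ℝ} (hf : 0 < f) (hK : c₀ * σ < K)
    (hsσ : c₀ * s ≤ c₀ * σ)
    (hP : Real.exp K * (f ^ ((3 : ℝ) / 2) * Real.exp (-(c₀ * s))) ≤ P)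
    (hpack : P ≤ f ^ ((3 : ℝ) / 2)) : False := by
  have hf32 : 0 < f ^ ((3 : ℝ) / 2) := Real.rpow_pos_of_pos hf _
  have h := hP.trans hpack
  have h2 : Real.exp K * Real.exp (-(c₀ * s)) ≤ Real.exp 0 := by
    rw [Real.exp_zero]
    refine le_of_mul_le_mul_right ?_ hf32
    calc Real.exp K * Real.exp (-(c₀ * s)) * f ^ ((3 : ℝ) / 2)
        = Real.exp K * (f ^ ((3 : ℝ) / 2) * Real.exp (-(c₀ * s))) := by ring
      _ ≤ f ^ ((3 : ℝ) / 2) := h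
      _ = 1 * f ^ ((3 : ℝ) / 2) := (one_mul _).symm
  rw [← Real.exp_add, Real.exp_le_exp] at h2
  linarith

/-- **Item `stmt-MatrixMultiplication-8309` (`DichotomyInduction`).**  The glue of route
`SnSubsetDichotomy`: `GlobalBranch → JuntaBranch → NoThresholdSubsetTriple`, with
`c := min (c₁/2) (1/2)` and `n₀ := 2 (max n₁ n₂ + 1)` (potential/descent argument of the module
docstring; Blasiak–Church–Cohn–Grochow–Umans 2017 §4 for the context, packing = Cohn–Umans 2003
Lemma 3.1). -/
theorem dichotomyInduction_proof : DichotomyInduction := by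
  unfold DichotomyInduction
  intro hGB hJB
  obtain ⟨ε, hε, c₁, hc₁, n₁, hG⟩ := hGB
  -- the constants
  set c₀ : ℝ := min (c₁ / 2) (1 / 2) with hc₀def
  have hc₀pos : 0 < c₀ := lt_min (half_pos hc₁) one_half_pos
  have hc₀lt : c₀ < c₁ := (min_le_left _ _).trans_lt (half_lt_self hc₁)
  have hc₀half : c₀ ≤ 1 / 2 := min_le_right _ _
  obtain ⟨n₂, hJ⟩ := hJB ε hε c₀ hc₀pos
  set M : ℕ := max n₁ n₂ + 1 with hMdef
  refine ⟨c₀, hc₀pos, 2 * M, fun n hn S T U hTPP => ?_⟩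
  by_contra hlt
  rw [not_le] at hlt
  have h2M : (2 * M : ℝ) ≤ n := by exact_mod_cast hn
  have hsqn : Real.sqrt n * Real.sqrt n = n := Real.mul_self_sqrt (Nat.cast_nonneg n)
  -- the descent: `R k` for all `k ≤ c₀√n + 1`
  have hR : ∀ k : ℕ, (k : ℝ) ≤ c₀ * Real.sqrt n + 1 → ∃ m : ℕ, m ≤ n ∧
      (n : ℝ) - k * Real.sqrt n ≤ m ∧ ∃ S T U : Finset (Equiv.Perm (Fin m)),
      TripleProductProperty S T U ∧
      Real.exp k * ((m.factorial : ℝ) ^ ((3 : ℝ) / 2) * Real.exp (-(c₀ * Real.sqrt m))) ≤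
        ((S.card * T.card * U.card : ℕ) : ℝ) := by
    intro k
    induction k with
    | zero =>
      intro _
      refine ⟨n, le_rfl, by simp, S, T, U, hTPP, ?_⟩
      simpa using hlt.le
    | succ k ih =>
      intro hk
      simp only [Nat.cast_add_one] at hk ⊢
      have hk' : (k : ℝ) ≤ c₀ * Real.sqrt n := by linarith
      obtain ⟨m, hmn, hkm, Sm, Tm, Um, hTPPm, hPm⟩ := ih (by linarith)
      -- the level stays above `M`
      have hkn : (k : ℝ) * Real.sqrt n ≤ c₀ * n := by
        calc (k : ℝ) * Real.sqrt n ≤ c₀ * Real.sqrt n * Real.sqrt n :=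
            mul_le_mul_of_nonneg_right hk' (Real.sqrt_nonneg _)
          _ = c₀ * n := by rw [mul_assoc, hsqn]
      have hc₀n : c₀ * n ≤ 1 / 2 * n := mul_le_mul_of_nonneg_right hc₀half (Nat.cast_nonneg n)
      have hMm : M ≤ m := by
        have h : (M : ℝ) ≤ m := by linarith
        exact_mod_cast h
      have hmax : max n₁ n₂ ≤ m := Nat.le_of_succ_le hMm
      have hm₁ : n₁ ≤ m := le_of_max_le_left hmax
      have hm₂ : n₂ ≤ m := le_of_max_le_right hmax
      have hm1 : 1 ≤ m := le_trans (Nat.le_add_left 1 _) hMm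
      have hfm : (0 : ℝ) < m.factorial := by exact_mod_cast m.factorial_pos
      have hsm : 0 < Real.sqrt m := Real.sqrt_pos.2 (by exact_mod_cast hm1)
      -- threshold at level `m`
      have hthr : (m.factorial : ℝ) ^ ((3 : ℝ) / 2) * Real.exp (-(c₀ * Real.sqrt m)) ≤
          ((Sm.card * Tm.card * Um.card : ℕ) : ℝ) :=
        le_trans (le_mul_of_one_le_left (by positivity) (Real.one_le_exp (Nat.cast_nonneg k))) hPm
      rcases dichotomyInduction_and_or_not (hG m hm₁ Sm Tm Um hTPPm) with ⟨-, hbound⟩ | hnb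
      · -- bump-free: contradicts `GlobalBranch`
        exact (dichotomyInduction_nobump_absurd hfm (Nat.cast_nonneg k) hc₀lt hsm hPm hbound).elim
      · -- a super-neutral bump: `JuntaBranch` descends
        push Not at hnb
        obtain ⟨m', hm'ge, hm'lt, S', T', U', hTPP', hP'⟩ := hJ m hm₂ Sm Tm Um hTPPm hthr hnb
        refine ⟨m', hm'lt.le.trans hmn, ?_, S', T', U', hTPP', ?_⟩
        · have hsmn : Real.sqrt m ≤ Real.sqrt n := Real.sqrt_le_sqrt (by exact_mod_cast hmn)
          linarith
        · exact dichotomyInduction_potential_step hc₀pos hfm (Nat.cast_nonneg _)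
            (by linarith [dichotomyInduction_sqrt_sub_one_le (Nat.cast_nonneg m) hm'ge]) hPm hP'
  -- the end of the descent: `K := ⌊c₀√n⌋ + 1` steps beat the packing bound
  have hc₀s : 0 ≤ c₀ * Real.sqrt n := mul_nonneg hc₀pos.le (Real.sqrt_nonneg _)
  obtain ⟨m, hmn, -, Sm, Tm, Um, hTPPm, hPm⟩ := hR (⌊c₀ * Real.sqrt n⌋₊ + 1)
    (by push_cast; linarith [Nat.floor_le hc₀s])
  have hfm : (0 : ℝ) < m.factorial := by exact_mod_cast m.factorial_pos
  have hsmn : Real.sqrt m ≤ Real.sqrt n := Real.sqrt_le_sqrt (by exact_mod_cast hmn)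
  refine dichotomyInduction_final_absurd hfm (K := ((⌊c₀ * Real.sqrt n⌋₊ + 1 : ℕ) : ℝ))
    (by push_cast; exact Nat.lt_floor_add_one _) (mul_le_mul_of_nonneg_left hsmn hc₀pos.le) hPm
    (dichotomyInduction_card_le_rpow hTPPm)

end Summit.MatrixMultiplication.MatrixMultiplication.Theorems
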